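import Mathlib.Topology.MetricSpace.Contracting
import Mathlib.Analysis.RCLike.Basic
import Mathlib.LinearAlgebra.FiniteDimensional.Lemmas
import HarnessLib

/-!
# Route `UnitScaleTilt`, crux K1 child «MinimiserStabilityRegPr» (stmt-QuantumFields-19200), skeleton v10, stub `stub_existenceMinimalOrbit` (EX), route (α) —
# **(ROW-R2q″, FILE 1) THE SOLVE DOOR: AN EXACT RIGHT INVERSE FROM AN APPROXIMATE ONE.**  If a linear `K : X → Y` composed with a linear "extension" `S : Y → X` is
# within `θκ` of `κ·id` on the complete normed space `Y` (`0 < κ`, `θ < 1`), then every `m ∈ Y` has an EXACT preimage `x = S c`, `K x = m`, with `‖c‖ ≤ ‖m‖∕(κ(1−θ))`; every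
# size row `p(S c) ≤ s·‖c‖` of the extension passes to the preimage as `p x ≤ (s∕(κ(1−θ)))·‖m‖`.

This is step (c) of ★w5-20520 g7's (P2-core) plan v2, memo `pub/ym3-torus/ym-ust-20520-w5/g7/LOCATE-P2-MARGIN-w5g7.md` v1.1 §(c) («the block-diagonal SOLVE by Neumann»), in the
form located in `pub/ym3-torus/ym3-torus-px10/LOCATE-R2q-px10g2.md` §5 (L1): NO locality theorem is needed — the contraction runs on the whole space of coarse fields as soon as the
estimate (d) «`‖𝓚_{A₁}(S c) − κ·c‖ ≤ θκ‖c‖`» holds in the norm the size rows use.  At the member: `X` = fine gauge parameters `Site (F.P K) 0 → M₂(ℂ)`, `Y` = coarse fields in the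
ℓ² currency of ROW-R2t, `K = 𝓚_{A₁}` (frame-corrected gauge operator, ✓`Prop7FrameLevelOnto.exists_frameCorrected_eq`'s letters), `S c = χ·Ad_P c(block)` (bump × framed constant),
rows `p₀ = ‖toL2S ·‖`, `p₁ = ‖DL2 U₀ (toL2S ·)‖`, `p₂ = ‖covLapSite U₀ (toL2S ·)‖` — instantiated in the sequel files; here the functional analysis only.

Cell `ym3-torus`, width seat `ym3-torus-px10` (gen 2).  THEOREMS ONLY (0 `def`, 0 `sorry`).  `--supports stmt-QuantumFields-19200 --as helper`, count-neutral.  YM₃ on T³ is a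
ladder rung (R3), not the Clay problem; nothing here claims the stub, the crux, d = 4 or the mass gap.

WHAT IS PROVED (sorry-free, no definition; ns `…Theorems.Prop7RightInverseOfApprox`; scalars `𝕜 = ℝ` or `ℂ` via `RCLike`):
* `lipschitz_step` — the corrector step `c ↦ c − κ⁻¹•(K(S c) − m)` is `θ`-Lipschitz under the approximation row;
* ★★★`exists_rightInverse_of_approx` — `∀ m, ∃ c, K (S c) = m ∧ ‖c‖ ≤ ‖m‖ ∕ (κ·(1−θ))` (Banach fixed point, ✓Mathlib `ContractingWith.fixedPoint`);
* ★★`exists_rightInverse_of_approx_rows` — the same with any family of size rows `p i (S c) ≤ s i·‖c‖` (`0 ≤ s i`) transported to the preimage: `p i x ≤ s i ∕ (κ(1−θ))·‖m‖`;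
* `norm_sub_smul_le_of_pointwise` — the POINTWISE form of (d) on a finite product (`‖f x₀ − κ•c x₀‖ ≤ θκ‖c x₀‖` for every index) gives the sup-norm form;
* ★★★`exists_rightInverse_of_approx_gauge` — the FINITE-DIMENSIONAL form for a DISPLAYED gauge `q : Y → ℝ` (subadditive, `q((r:𝕜)•a) = |r|q a`, definite) in place of a norm, `0 ≤ θ` not needed —
  the shape the (P2-core) rows assembler uses (`q m = √(c₀η⁻³Σ_y‖m y‖_F²)`): `K∘S` injective ⇒ onto; `q c ≤ q m∕(κ(1−θ))`.
HONEST SCOPE: abstract functional analysis; the member instantiation (the linear response letter, the estimate (d), the extension rows) is the sequel's; nothing of print asserted.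

References: T. Bałaban, CMP 99 (1985) 389–434 [Balaban1985BackgroundPropagators] ((3.114)–(3.115) p.418: the inductive solution of the averaging constraint);
CMP 98 (1985) 17–51 [Balaban1985Averaging] ((97) p.32).
-/

set_option autoImplicit false

noncomputable section

open scoped NNReal Topology
open Filter Metric Function

namespace Summit.QuantumFields.YangMills.Theorems.Prop7RightInverseOfApprox

variable {𝕜 : Type*} [RCLike 𝕜] {X Y : Type*} [AddCommGroup X] [Module 𝕜 X] [NormedAddCommGroup Y] [NormedSpace 𝕜 Y]

/-! ## §1 The corrector step is a contraction -/

/-- The corrector step `T c := c − κ⁻¹•(K(S c) − m)` moves two points `c₁, c₂` to within `θ·‖c₁ − c₂‖` of each other when `‖K(S c) − κ•c‖ ≤ θκ‖c‖` for all `c`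
(linearity of `K∘S` on the difference). [folklore] -/
theorem lipschitz_step (K : X →ₗ[𝕜] Y) (S : Y →ₗ[𝕜] X) {κ θ : ℝ} (hκ : 0 < κ)
    (happrox : ∀ c : Y, ‖K (S c) - ((κ : ℝ) : 𝕜) • c‖ ≤ θ * κ * ‖c‖) (m c₁ c₂ : Y) :
    ‖(c₁ - (((κ : ℝ) : 𝕜)⁻¹) • (K (S c₁) - m)) - (c₂ - (((κ : ℝ) : 𝕜)⁻¹) • (K (S c₂) - m))‖ ≤ θ * ‖c₁ - c₂‖ := by
  have hκ𝕜 : ((κ : ℝ) : 𝕜) ≠ 0 := by exact_mod_cast hκ.ne'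
  have hlin : K (S c₁) - K (S c₂) = K (S (c₁ - c₂)) := by rw [map_sub, map_sub]
  have heq : (c₁ - (((κ : ℝ) : 𝕜)⁻¹) • (K (S c₁) - m)) - (c₂ - (((κ : ℝ) : 𝕜)⁻¹) • (K (S c₂) - m))
      = -((((κ : ℝ) : 𝕜)⁻¹) • (K (S (c₁ - c₂)) - ((κ : ℝ) : 𝕜) • (c₁ - c₂))) := by
    rw [← hlin]
    simp only [smul_sub, smul_smul, inv_mul_cancel₀ hκ𝕜, one_smul]
    abel
  rw [heq, norm_neg, norm_smul, norm_inv, RCLike.norm_ofReal, abs_of_pos hκ]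
  calc κ⁻¹ * ‖K (S (c₁ - c₂)) - ((κ : ℝ) : 𝕜) • (c₁ - c₂)‖ ≤ κ⁻¹ * (θ * κ * ‖c₁ - c₂‖) :=
        mul_le_mul_of_nonneg_left (happrox _) (inv_nonneg.mpr hκ.le)
    _ = θ * ‖c₁ - c₂‖ := by field_simp

/-! ## §2 The exact right inverse -/

/-- ★★★ **AN EXACT RIGHT INVERSE FROM AN APPROXIMATE ONE.**  `K : X → Y`, `S : Y → X` linear, `Y` complete, `0 < κ`, `0 ≤ θ < 1`, and `‖K(S c) − κ•c‖ ≤ θκ‖c‖` for all `c`.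
Then every `m` is hit: `∃ c, K (S c) = m`, with `‖c‖ ≤ ‖m‖∕(κ(1 − θ))`.  Proof: the corrector step of `lipschitz_step` is a `θ`-contraction of the complete space `Y`; its fixed
point `c` has `κ⁻¹•(K(S c) − m) = 0`, and `‖c‖ ≤ θ‖c‖ + ‖κ⁻¹•m‖`. [cite: Balaban1985BackgroundPropagators, (3.114)-(3.115) p.418] -/
theorem exists_rightInverse_of_approx [CompleteSpace Y] (K : X →ₗ[𝕜] Y) (S : Y →ₗ[𝕜] X) {κ θ : ℝ} (hκ : 0 < κ) (hθ0 : 0 ≤ θ) (hθ1 : θ < 1)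
    (happrox : ∀ c : Y, ‖K (S c) - ((κ : ℝ) : 𝕜) • c‖ ≤ θ * κ * ‖c‖) (m : Y) :
    ∃ c : Y, K (S c) = m ∧ ‖c‖ ≤ ‖m‖ / (κ * (1 - θ)) := by
  have hκ𝕜 : ((κ : ℝ) : 𝕜) ≠ 0 := by exact_mod_cast hκ.ne'
  set T : Y → Y := fun c => c - (((κ : ℝ) : 𝕜)⁻¹) • (K (S c) - m) with hT
  have hLip : LipschitzWith ⟨θ, hθ0⟩ T := by
    refine LipschitzWith.of_dist_le_mul fun c₁ c₂ => ?_
    rw [dist_eq_norm, dist_eq_norm]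
    exact lipschitz_step K S hκ happrox m c₁ c₂
  have hC : ContractingWith ⟨θ, hθ0⟩ T := ⟨by exact_mod_cast hθ1, hLip⟩
  haveI : Nonempty Y := ⟨0⟩
  set c : Y := ContractingWith.fixedPoint T hC with hc
  have hfix : T c = c := ContractingWith.fixedPoint_isFixedPt hC
  refine ⟨c, ?_, ?_⟩
  · -- `T c = c` says `κ⁻¹•(K(S c) − m) = 0`
    have h1 : (((κ : ℝ) : 𝕜)⁻¹) • (K (S c) - m) = 0 := by
      have h2 : c - (((κ : ℝ) : 𝕜)⁻¹) • (K (S c) - m) = c := hfix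
      have h3 : c - (((κ : ℝ) : 𝕜)⁻¹) • (K (S c) - m) = c - 0 := by rw [h2, sub_zero]
      exact sub_right_injective h3
    rcases smul_eq_zero.mp h1 with h | h
    · exact absurd h (inv_ne_zero hκ𝕜)
    · exact sub_eq_zero.mp h
  · -- `‖c‖ ≤ θ‖c‖ + κ⁻¹‖m‖`
    have hT0 : T 0 = (((κ : ℝ) : 𝕜)⁻¹) • m := by
      simp only [hT, map_zero, zero_sub, smul_neg, neg_neg]
    have hstep : ‖T c - T 0‖ ≤ θ * ‖c - 0‖ := by
      have := hLip.dist_le_mul c 0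
      rw [dist_eq_norm, dist_eq_norm] at this
      exact this
    rw [sub_zero, hfix, hT0] at hstep
    have hn : ‖(((κ : ℝ) : 𝕜)⁻¹) • m‖ = κ⁻¹ * ‖m‖ := by
      rw [norm_smul, norm_inv, RCLike.norm_ofReal, abs_of_pos hκ]
    have hle : ‖c‖ ≤ θ * ‖c‖ + κ⁻¹ * ‖m‖ := by
      calc ‖c‖ = ‖(c - (((κ : ℝ) : 𝕜)⁻¹) • m) + (((κ : ℝ) : 𝕜)⁻¹) • m‖ := by rw [sub_add_cancel]
        _ ≤ ‖c - (((κ : ℝ) : 𝕜)⁻¹) • m‖ + ‖(((κ : ℝ) : 𝕜)⁻¹) • m‖ := norm_add_le _ _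
        _ ≤ θ * ‖c‖ + κ⁻¹ * ‖m‖ := by rw [hn]; exact add_le_add hstep le_rfl
    have h1θ : 0 < 1 - θ := by linarith
    rw [le_div_iff₀ (mul_pos hκ h1θ)]
    have : (1 - θ) * ‖c‖ ≤ κ⁻¹ * ‖m‖ := by nlinarith
    calc ‖c‖ * (κ * (1 - θ)) = κ * ((1 - θ) * ‖c‖) := by ring
      _ ≤ κ * (κ⁻¹ * ‖m‖) := mul_le_mul_of_nonneg_left this hκ.le
      _ = ‖m‖ := by field_simp

/-- ★★ **THE SIZE ROWS OF THE EXTENSION PASS TO THE EXACT PREIMAGE.**  Under the hypotheses of `exists_rightInverse_of_approx`, if the extension satisfies size rows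
`p i (S c) ≤ s i·‖c‖` (`0 ≤ s i`; e.g. `p₀ = ‖toL2S ·‖`, `p₁ = ‖DL2 U₀ (toL2S ·)‖`, `p₂ = ‖covLapSite U₀ (toL2S ·)‖` at the member), then every `m` has a preimage `x` (`K x = m`) with
`p i x ≤ (s i ∕ (κ(1−θ)))·‖m‖` for every `i` — the (Q4-H²) shape «`∃ N, 𝓚_{A₁}N = m ∧ ‖N‖ ≤ C₀‖m‖ ∧ ‖DN‖ ≤ C₁‖m‖ ∧ ‖Δ^ηN‖ ≤ C₂‖m‖`». [cite: Balaban1985BackgroundPropagators, (3.114)-(3.115) p.418] -/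
theorem exists_rightInverse_of_approx_rows [CompleteSpace Y] {ι : Type*} (K : X →ₗ[𝕜] Y) (S : Y →ₗ[𝕜] X) {κ θ : ℝ} (hκ : 0 < κ) (hθ0 : 0 ≤ θ) (hθ1 : θ < 1)
    (happrox : ∀ c : Y, ‖K (S c) - ((κ : ℝ) : 𝕜) • c‖ ≤ θ * κ * ‖c‖)
    (p : ι → X → ℝ) (s : ι → ℝ) (hs : ∀ i, 0 ≤ s i) (hrow : ∀ i (c : Y), p i (S c) ≤ s i * ‖c‖) (m : Y) :
    ∃ x : X, K x = m ∧ ∀ i, p i x ≤ s i / (κ * (1 - θ)) * ‖m‖ := by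
  obtain ⟨c, hc, hcn⟩ := exists_rightInverse_of_approx K S hκ hθ0 hθ1 happrox m
  refine ⟨S c, hc, fun i => (hrow i c).trans ?_⟩
  rw [div_mul_eq_mul_div, le_div_iff₀ (mul_pos hκ (by linarith))]
  have h1 : s i * ‖c‖ * (κ * (1 - θ)) = s i * (‖c‖ * (κ * (1 - θ))) := by ring
  rw [h1]
  refine mul_le_mul_of_nonneg_left ?_ (hs i)
  rwa [le_div_iff₀ (mul_pos hκ (by linarith))] at hcn

/-! ## §3 The pointwise form of the approximation row gives the sup-norm form -/

/-- On a finite product `Π x, E` (sup norm), the POINTWISE estimate `‖f x − κ•c x‖ ≤ θκ‖c x‖` at every index gives `‖f − κ•c‖ ≤ θκ‖c‖` — the form in which the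
block-diagonal estimate (d) of the (P2-core) plan feeds `exists_rightInverse_of_approx` when the coarse fields carry the sup norm. [folklore] -/
theorem norm_sub_smul_le_of_pointwise {α : Type*} [Fintype α] {E : Type*} [NormedAddCommGroup E] [NormedSpace 𝕜 E] {κ θ : ℝ} (hθκ : 0 ≤ θ * κ)
    (f c : α → E) (h : ∀ x, ‖f x - ((κ : ℝ) : 𝕜) • c x‖ ≤ θ * κ * ‖c x‖) :
    ‖f - ((κ : ℝ) : 𝕜) • c‖ ≤ θ * κ * ‖c‖ := by
  refine (pi_norm_le_iff_of_nonneg (mul_nonneg hθκ (norm_nonneg _))).mpr fun x => ?_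
  rw [Pi.sub_apply, Pi.smul_apply]
  exact (h x).trans (mul_le_mul_of_nonneg_left (norm_le_pi_norm c x) hθκ)

/-! ## §4 Finite-dimensional form with a bare sublinear gauge (the coarse ℓ² currency of record is a displayed `Real.sqrt` sum, not a type's norm) -/

/-- ★★★ **THE SOLVE DOOR FOR A DISPLAYED GAUGE.**  `Y` finite-dimensional over `𝕜`; `q : Y → ℝ` subadditive, absolutely homogeneous for REAL scalars and definite
(`q (a + b) ≤ q a + q b`, `q ((r:𝕜) • a) = |r|·q a`, `q a = 0 → a = 0` — e.g. the coarse currency `q m = √(c₀η⁻³·Σ_y ‖m y‖_F²)` of ★w5-20520 g7's rows assembler); `K : X → Y`,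
`S : Y → X` linear with `q (K (S c) − κ•c) ≤ θκ·q c` (`0 < κ`, `0 ≤ θ < 1`).  Then every `m` has `c` with `K (S c) = m` and `q c ≤ q m ∕ (κ(1−θ))`.  Proof: `K∘S` is injective
(`κ q c ≤ θκ q c` forces `q c = 0`), hence onto (finite dimension, ✓`LinearMap.injective_iff_surjective`); the bound is the triangle inequality `κ q c ≤ q(κc − KSc) + q m`.
[cite: Balaban1985BackgroundPropagators, (3.114)-(3.115) p.418] -/
theorem exists_rightInverse_of_approx_gauge {Y' : Type*} [AddCommGroup Y'] [Module 𝕜 Y'] [FiniteDimensional 𝕜 Y'] (K : X →ₗ[𝕜] Y') (S : Y' →ₗ[𝕜] X)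
    (q : Y' → ℝ) (hq_add : ∀ a b, q (a + b) ≤ q a + q b) (hq_smul : ∀ (r : ℝ) (a : Y'), q (((r : ℝ) : 𝕜) • a) = |r| * q a) (hq_def : ∀ a, q a = 0 → a = 0)
    {κ θ : ℝ} (hκ : 0 < κ) (hθ1 : θ < 1) (happrox : ∀ c : Y', q (K (S c) - ((κ : ℝ) : 𝕜) • c) ≤ θ * κ * q c) (m : Y') :
    ∃ c : Y', K (S c) = m ∧ q c ≤ q m / (κ * (1 - θ)) := by
  -- elementary consequences of the three gauge axioms (`0 ≤ θ` is not needed)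
  have hq_neg : ∀ a, q (-a) = q a := fun a => by
    have h := hq_smul (-1) a
    rwa [show (((-1 : ℝ) : ℝ) : 𝕜) • a = -a by push_cast; rw [neg_one_smul], abs_neg, abs_one, one_mul] at h
  have hq_zero : q 0 = 0 := by
    have h := hq_smul 0 (0 : Y')
    rwa [smul_zero, abs_zero, zero_mul] at h
  have hq_nonneg : ∀ a, 0 ≤ q a := fun a => by
    have h := hq_add a (-a)
    rw [add_neg_cancel, hq_zero, hq_neg] at h
    linarith
  have hq_κ : ∀ a, q (((κ : ℝ) : 𝕜) • a) = κ * q a := fun a => by rw [hq_smul, abs_of_pos hκ]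
  -- the key inequality `κ q c ≤ θκ q c + q (K (S c))`
  have hkey : ∀ c, κ * q c ≤ θ * κ * q c + q (K (S c)) := fun c => by
    have h1 : ((κ : ℝ) : 𝕜) • c = -(K (S c) - ((κ : ℝ) : 𝕜) • c) + K (S c) := by abel
    calc κ * q c = q (((κ : ℝ) : 𝕜) • c) := (hq_κ c).symm
      _ = q (-(K (S c) - ((κ : ℝ) : 𝕜) • c) + K (S c)) := by rw [← h1]
      _ ≤ q (-(K (S c) - ((κ : ℝ) : 𝕜) • c)) + q (K (S c)) := hq_add _ _
      _ ≤ θ * κ * q c + q (K (S c)) := by rw [hq_neg]; exact add_le_add (happrox c) le_rfl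
  -- `K∘S` is injective, hence onto
  set L : Y' →ₗ[𝕜] Y' := K ∘ₗ S with hL
  have hinj : Function.Injective L := by
    intro a b hab
    have h0 : L (a - b) = 0 := by rw [map_sub, hab, sub_self]
    have h1 : K (S (a - b)) = 0 := h0
    have h2 := hkey (a - b)
    rw [h1, hq_zero, add_zero] at h2
    have h3 : (1 - θ) * κ * q (a - b) ≤ 0 := by nlinarith
    have h1θ : 0 < 1 - θ := by linarith
    have h4 : q (a - b) ≤ 0 := le_of_not_gt fun h5 => by
      have : 0 < (1 - θ) * κ * q (a - b) := by positivity
      linarith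
    exact sub_eq_zero.mp (hq_def _ (le_antisymm h4 (hq_nonneg _)))
  have hsurj : Function.Surjective L := LinearMap.injective_iff_surjective.mp hinj
  obtain ⟨c, hc⟩ := hsurj m
  have hc' : K (S c) = m := hc
  refine ⟨c, hc', ?_⟩
  rw [le_div_iff₀ (mul_pos hκ (by linarith))]
  have h := hkey c
  rw [hc'] at h
  nlinarith

end Summit.QuantumFields.YangMills.Theorems.Prop7RightInverseOfApprox

end
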